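import Literature.AlgebraicGeometry.Resolution.RegularSystemOfParameters
import Mathlib.RingTheory.Nakayama
import HarnessLib

/-!
# Crux `PatchingRelPerfect` (stmt-ResolutionOfSingularities-16161), chain w52 — depth-two one-form
# members over the quadric cone: the NORMAL FORM of the non-permissible tails

[OURS · L1 W5.2 · rung] Pure commutative algebra in a local ring `S` with a generating family
`x₀, …, x₃` of `𝔪` (no regularity needed).  A depth-two one-form member over the cone
`q = x₀x₁ + x₂²` is `I = (q + g) + 𝔪⁴`, `g ∈ 𝔪³ = P𝔪² + (x₃³)`, `P = (x₀, x₁, x₂)`; write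
`g = p + λ x₃³`.  For `λ ∈ 𝔪` the member is weight-two-permissible (`…ConeAdd`).  For `λ` a UNIT
we PROVE that after a change of the regular system of parameters the member is the
contact-migration member of `…ConeCube`:

* `span_eq_maximalIdeal_of_forall_mem_sup` — Nakayama: if `y_i ∈ 𝔪` and `x_i ∈ (y) + 𝔪²` then
  `(y) = 𝔪`;
* `coneTail_absorb` — `q + p = y₀y₁ + ε y₂² + γ y₂y₃² + r`, `r ∈ 𝔪⁴`, `ε` a unit
  (`y₀ = x₀ + …`, `y₁ = x₁ + …`, `y₂ = x₂`, `y₃ = x₃`);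
* `coneTail_kill_two` / `coneTail_kill_three` — the term `γ y₂y₃²` is removed by
  `y₂ ↦ y₂ + (γ/2ε) y₃²` when `2` is a unit, by `y₃ ↦ y₃ + (γ/3λ) y₂` when `3` is a unit (one of
  `2`, `3` is a unit of a local ring: `isUnit_two_or_three`);
* `coneTail_rescale` — `z₀z₁ + ε z₂² + λ z₃³ = η · (w₀w₁ + w₂² + w₃³)` for units `ε, λ`
  (`w = (λ²ε⁻³ z₀, z₁, λε⁻¹ z₂, λε⁻¹ z₃)`, `η = ε³λ⁻²`);
* **`exists_rsop_coneCube_of_isUnit`** — for `p ∈ P𝔪²` and `λ` a unit there are a generating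
  family `y` of `𝔪`, a unit `η` and `r ∈ 𝔪⁴` with
  `x₀x₁ + x₂² + p + λx₃³ = η (y₀y₁ + y₂² + y₃³) + r`.

Nothing here is a statement of the manuscript under review.

## References

* H. Matsumura, *Commutative Ring Theory*, CUP 1986, Thm. 2.2 (Nakayama). [Matsumura1987]
-/

-- `Summit.<Summit>.<Sub>.Theorems` with `Sub = Summit` (single-conjunct summit, D-0017)
set_option linter.dupNamespace false

noncomputable section

open IsLocalRing

namespace Summit.ResolutionOfSingularities.ResolutionOfSingularities.Theorems

namespace ConeRung

universe u

/-! ## Generic lemmas: decompositions, units, Nakayama -/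

section Generic

variable {S : Type u} [CommRing S]

/-- Decomposition in `(u, v, w) · J`. [folklore] -/
theorem exists_of_mem_span_triple_mul {u v w z : S} {J : Ideal S}
    (h : z ∈ Ideal.span {u, v, w} * J) :
    ∃ a ∈ J, ∃ b ∈ J, ∃ c ∈ J, z = u * a + v * b + w * c := by
  rw [Ideal.span_insert, Ideal.span_insert, Ideal.sup_mul, Ideal.sup_mul] at h
  obtain ⟨p₁, hp₁, q₁, hq₁, rfl⟩ := Submodule.mem_sup.mp h
  obtain ⟨p₂, hp₂, p₃, hp₃, rfl⟩ := Submodule.mem_sup.mp hq₁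
  obtain ⟨a, ha, rfl⟩ := Ideal.mem_span_singleton_mul.mp hp₁
  obtain ⟨b, hb, rfl⟩ := Ideal.mem_span_singleton_mul.mp hp₂
  obtain ⟨c, hc, rfl⟩ := Ideal.mem_span_singleton_mul.mp hp₃
  exact ⟨a, ha, b, hb, c, hc, by ring⟩

/-- Decomposition in `(t, u, v, w) · J`. [folklore] -/
theorem exists_of_mem_span_four_mul {t u v w z : S} {J : Ideal S}
    (h : z ∈ Ideal.span {t, u, v, w} * J) :
    ∃ a ∈ J, ∃ b ∈ J, ∃ c ∈ J, ∃ d ∈ J, z = t * a + u * b + v * c + w * d := by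
  rw [Ideal.span_insert, Ideal.sup_mul] at h
  obtain ⟨p₁, hp₁, q₁, hq₁, rfl⟩ := Submodule.mem_sup.mp h
  obtain ⟨a, ha, rfl⟩ := Ideal.mem_span_singleton_mul.mp hp₁
  obtain ⟨b, hb, c, hc, d, hd, rfl⟩ := exists_of_mem_span_triple_mul hq₁
  exact ⟨a, ha, b, hb, c, hc, d, hd, by ring⟩

/-- `(x₀, x₁, x₂, x₃)` as the span of a range. [folklore] -/
theorem span_range_four (x : Fin 4 → S) :
    Ideal.span (Set.range x) = Ideal.span {x 0, x 1, x 2, x 3} := by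
  congr 1
  ext y
  simp only [Set.mem_range, Set.mem_insert_iff, Set.mem_singleton_iff]
  constructor
  · rintro ⟨k, rfl⟩
    fin_cases k
    · exact Or.inl rfl
    · exact Or.inr (Or.inl rfl)
    · exact Or.inr (Or.inr (Or.inl rfl))
    · exact Or.inr (Or.inr (Or.inr rfl))
  · rintro (rfl | rfl | rfl | rfl)
    · exact ⟨0, rfl⟩
    · exact ⟨1, rfl⟩
    · exact ⟨2, rfl⟩
    · exact ⟨3, rfl⟩

/-- `y i ∈ (y)`. [folklore] -/
theorem vec_mem_span_range {n : ℕ} (y : Fin n → S) (i : Fin n) : y i ∈ Ideal.span (Set.range y) :=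
  Ideal.subset_span ⟨i, rfl⟩

variable [IsLocalRing S]

/-- A unit plus an element of `𝔪` is a unit. [folklore] -/
theorem isUnit_add_of_mem_maximalIdeal {ε m : S} (hε : IsUnit ε) (hm : m ∈ maximalIdeal S) :
    IsUnit (ε + m) := by
  by_contra h
  have h1 : ε + m ∈ maximalIdeal S := h
  have h2 : ε ∈ maximalIdeal S := by
    have := Ideal.sub_mem _ h1 hm
    rwa [add_sub_cancel_right] at this
  exact (notMem_maximalIdeal.mpr hε) h2

/-- In a local ring one of `2`, `3` is a unit. [folklore] -/
theorem isUnit_two_or_three : IsUnit (2 : S) ∨ IsUnit (3 : S) := by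
  by_cases h2 : IsUnit (2 : S)
  · exact Or.inl h2
  · right
    by_contra h3
    have h2' : (2 : S) ∈ maximalIdeal S := h2
    have h3' : (3 : S) ∈ maximalIdeal S := h3
    have h1 : (1 : S) ∈ maximalIdeal S := by
      have := Ideal.sub_mem _ h3' h2'
      rwa [show (3 : S) - 2 = 1 by norm_num] at this
    exact (notMem_maximalIdeal.mpr isUnit_one) h1

/-- **Nakayama**: if `(x) = 𝔪`, `y_i ∈ 𝔪` and `x_i ∈ (y) + 𝔪²` for all `i`, then `(y) = 𝔪`.
[cite: Matsumura1987, Thm. 2.2] -/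
theorem span_eq_maximalIdeal_of_forall_mem_sup [IsNoetherianRing S] {n m : ℕ} (x : Fin n → S)
    (y : Fin m → S) (hx : Ideal.span (Set.range x) = maximalIdeal S)
    (hy : ∀ i, y i ∈ maximalIdeal S)
    (hxy : ∀ i, x i ∈ Ideal.span (Set.range y) ⊔ maximalIdeal S ^ 2) :
    Ideal.span (Set.range y) = maximalIdeal S := by
  apply le_antisymm
  · rw [Ideal.span_le]
    rintro _ ⟨i, rfl⟩
    exact hy i
  · refine Submodule.le_of_le_smul_of_le_jacobson_bot (IsNoetherian.noetherian _)
      (IsLocalRing.maximalIdeal_le_jacobson _) ?_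
    rw [Ideal.smul_eq_mul, ← sq, ← hx, Ideal.span_le]
    rintro _ ⟨i, rfl⟩
    rw [hx]
    exact hxy i

end Generic

/-! ## The normal form -/

section NormalForm

variable {S : Type u} [CommRing S] [IsLocalRing S] [IsNoetherianRing S] (x : Fin 4 → S)
  (hx : Ideal.span (Set.range x) = maximalIdeal S)

local notation3 "𝔪" => IsLocalRing.maximalIdeal S

omit [IsNoetherianRing S] in
include hx in
/-- `x_i ∈ 𝔪`. [folklore] -/
theorem rsop_mem (i : Fin 4) : x i ∈ 𝔪 := hx ▸ Ideal.subset_span ⟨i, rfl⟩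

include hx in
/-- **Step A — absorbing a weight-two-permissible tail**: for `p ∈ (x₀,x₁,x₂)·𝔪²` there are a
generating family `y` of `𝔪` with `y₂ = x₂`, `y₃ = x₃`, a unit `ε`, `γ ∈ S` and `r ∈ 𝔪⁴` with
`x₀x₁ + x₂² + p = y₀y₁ + ε y₂² + γ y₂y₃² + r`. [folklore] -/
theorem coneTail_absorb (p : S) (hp : p ∈ Ideal.span {x 0, x 1, x 2} * 𝔪 ^ 2) :
    ∃ (y : Fin 4 → S), Ideal.span (Set.range y) = 𝔪 ∧ y 2 = x 2 ∧ y 3 = x 3 ∧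
      ∃ (ε γ r : S), IsUnit ε ∧ r ∈ 𝔪 ^ 4 ∧
        x 0 * x 1 + x 2 ^ 2 + p = y 0 * y 1 + ε * y 2 ^ 2 + γ * (y 2 * y 3 ^ 2) + r := by
  have hm := rsop_mem x hx
  obtain ⟨a, ha, b, hb, c, hc, hpabc⟩ := exists_of_mem_span_triple_mul hp
  -- `c ∈ 𝔪² = (x)·𝔪`
  have hc' : c ∈ Ideal.span {x 0, x 1, x 2, x 3} * 𝔪 := by
    rwa [← span_range_four, hx, ← sq]
  obtain ⟨c₀, hc₀, c₁, hc₁, c₂, hc₂, c₃, hc₃, hcdec⟩ := exists_of_mem_span_four_mul hc'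
  -- `c₃ ∈ 𝔪 = (x)`
  have hc₃' : c₃ ∈ Ideal.span (Set.range x) := hx ▸ hc₃
  obtain ⟨d, hd⟩ := Ideal.mem_span_range_iff_exists_fun.mp hc₃'
  set A := a + x 2 * c₀ + x 2 * x 3 * d 0 with hA
  set B := b + x 2 * c₁ + x 2 * x 3 * d 1 with hB
  have hA2 : A ∈ 𝔪 ^ 2 := by
    refine Ideal.add_mem _ (Ideal.add_mem _ ha ?_) ?_
    · rw [sq]; exact Ideal.mul_mem_mul (hm 2) hc₀
    · rw [sq]; exact Ideal.mul_mem_right _ _ (Ideal.mul_mem_mul (hm 2) (hm 3))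
  have hB2 : B ∈ 𝔪 ^ 2 := by
    refine Ideal.add_mem _ (Ideal.add_mem _ hb ?_) ?_
    · rw [sq]; exact Ideal.mul_mem_mul (hm 2) hc₁
    · rw [sq]; exact Ideal.mul_mem_right _ _ (Ideal.mul_mem_mul (hm 2) (hm 3))
  refine ⟨![x 0 + B, x 1 + A, x 2, x 3], ?_, rfl, rfl, 1 + (c₂ + x 3 * d 2), d 3, -(A * B),
    isUnit_add_of_mem_maximalIdeal isUnit_one
      (Ideal.add_mem _ hc₂ (Ideal.mul_mem_right _ _ (hm 3))), ?_, ?_⟩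
  · refine span_eq_maximalIdeal_of_forall_mem_sup x _ hx (fun i => ?_) (fun i => ?_)
    · fin_cases i
      · exact Ideal.add_mem _ (hm 0) (Ideal.pow_le_self two_ne_zero hB2)
      · exact Ideal.add_mem _ (hm 1) (Ideal.pow_le_self two_ne_zero hA2)
      · exact hm 2
      · exact hm 3
    · have hv := vec_mem_span_range (![x 0 + B, x 1 + A, x 2, x 3] : Fin 4 → S)
      fin_cases i
      · have h : x 0 + B - B ∈ Ideal.span (Set.range (![x 0 + B, x 1 + A, x 2, x 3] : Fin 4 → S)) ⊔
            𝔪 ^ 2 := Ideal.sub_mem _ (Ideal.mem_sup_left (by simpa using hv 0)) (Ideal.mem_sup_right hB2)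
        rwa [add_sub_cancel_right] at h
      · have h : x 1 + A - A ∈ Ideal.span (Set.range (![x 0 + B, x 1 + A, x 2, x 3] : Fin 4 → S)) ⊔
            𝔪 ^ 2 := Ideal.sub_mem _ (Ideal.mem_sup_left (by simpa using hv 1)) (Ideal.mem_sup_right hA2)
        rwa [add_sub_cancel_right] at h
      · exact Ideal.mem_sup_left (by simpa using hv 2)
      · exact Ideal.mem_sup_left (by simpa using hv 3)
  · rw [neg_mem_iff, show (4 : ℕ) = 2 + 2 from rfl, pow_add]
    exact Ideal.mul_mem_mul hA2 hB2
  · simp only [Matrix.cons_val_zero, Matrix.cons_val_one, Matrix.cons_val]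
    rw [hpabc, hcdec, ← hd, Fin.sum_univ_four, hA, hB]
    ring

include hx in
/-- **Step B, `2` a unit**: `y₀y₁ + ε y₂² + γ y₂y₃² + λ y₃³ = z₀z₁ + ε z₂² + λ z₃³ + r'` with
`z₂ = y₂ + (γ/2ε) y₃²`, `r' ∈ 𝔪⁴`. [folklore] -/
theorem coneTail_kill_two (h2 : IsUnit (2 : S)) (ε γ lam : S) (hε : IsUnit ε) :
    ∃ (z : Fin 4 → S), Ideal.span (Set.range z) = 𝔪 ∧
      ∃ (ε' r : S), IsUnit ε' ∧ r ∈ 𝔪 ^ 4 ∧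
        x 0 * x 1 + ε * x 2 ^ 2 + γ * (x 2 * x 3 ^ 2) + lam * x 3 ^ 3 =
          z 0 * z 1 + ε' * z 2 ^ 2 + lam * z 3 ^ 3 + r := by
  have hm := rsop_mem x hx
  obtain ⟨e', he'⟩ := hε.exists_right_inv
  obtain ⟨t, ht⟩ := h2.exists_right_inv
  set δ := γ * e' * t with hδ
  refine ⟨![x 0, x 1, x 2 + δ * x 3 ^ 2, x 3], ?_, ε, -(ε * δ ^ 2 * x 3 ^ 4), hε, ?_, ?_⟩
  · refine span_eq_maximalIdeal_of_forall_mem_sup x _ hx (fun i => ?_) (fun i => ?_)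
    · fin_cases i
      · exact hm 0
      · exact hm 1
      · exact Ideal.add_mem _ (hm 2) (Ideal.mul_mem_left _ _ (Ideal.pow_mem_of_mem 𝔪 (hm 3) 2 two_pos))
      · exact hm 3
    · have hv := vec_mem_span_range (![x 0, x 1, x 2 + δ * x 3 ^ 2, x 3] : Fin 4 → S)
      fin_cases i
      · exact Ideal.mem_sup_left (by simpa using hv 0)
      · exact Ideal.mem_sup_left (by simpa using hv 1)
      · have h : x 2 + δ * x 3 ^ 2 - δ * x 3 ^ 2 ∈
            Ideal.span (Set.range (![x 0, x 1, x 2 + δ * x 3 ^ 2, x 3] : Fin 4 → S)) ⊔ 𝔪 ^ 2 :=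
          Ideal.sub_mem _ (Ideal.mem_sup_left (by simpa using hv 2))
            (Ideal.mem_sup_right (Ideal.mul_mem_left _ δ (Ideal.pow_mem_pow (hm 3) 2)))
        rwa [add_sub_cancel_right] at h
      · exact Ideal.mem_sup_left (by simpa using hv 3)
  · rw [neg_mem_iff]
    exact Ideal.mul_mem_left _ _ (Ideal.pow_mem_pow (hm 3) 4)
  · simp only [Matrix.cons_val_zero, Matrix.cons_val_one, Matrix.cons_val]
    rw [hδ]
    linear_combination (-(γ * (x 2 * x 3 ^ 2))) * he' + (-(γ * (x 2 * x 3 ^ 2) * (ε * e'))) * ht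

include hx in
/-- **Step B, `3` a unit**: `y₀y₁ + ε y₂² + γ y₂y₃² + λ y₃³ = z₀z₁ + ε' z₂² + λ z₃³` with
`z₃ = y₃ + (γ/3λ) y₂`. [folklore] -/
theorem coneTail_kill_three (h3 : IsUnit (3 : S)) (ε γ lam : S) (hε : IsUnit ε)
    (hlam : IsUnit lam) :
    ∃ (z : Fin 4 → S), Ideal.span (Set.range z) = 𝔪 ∧
      ∃ (ε' r : S), IsUnit ε' ∧ r ∈ 𝔪 ^ 4 ∧
        x 0 * x 1 + ε * x 2 ^ 2 + γ * (x 2 * x 3 ^ 2) + lam * x 3 ^ 3 =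
          z 0 * z 1 + ε' * z 2 ^ 2 + lam * z 3 ^ 3 + r := by
  have hm := rsop_mem x hx
  obtain ⟨s, hs⟩ := (h3.mul hlam).exists_right_inv
  set δ := γ * s with hδ
  -- `m` collects the new `y₂²`-coefficients; it lies in `𝔪`
  set m := (3 * lam * δ ^ 2 - 2 * γ * δ) * (x 3 + δ * x 2) + (γ * δ ^ 2 - lam * δ ^ 3) * x 2
    with hmdef
  have hmm : m ∈ 𝔪 :=
    Ideal.add_mem _ (Ideal.mul_mem_left _ _ (Ideal.add_mem _ (hm 3) (Ideal.mul_mem_left _ _ (hm 2))))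
      (Ideal.mul_mem_left _ _ (hm 2))
  refine ⟨![x 0, x 1, x 2, x 3 + δ * x 2], ?_, ε + m, 0, isUnit_add_of_mem_maximalIdeal hε hmm,
    Ideal.zero_mem _, ?_⟩
  · refine span_eq_maximalIdeal_of_forall_mem_sup x _ hx (fun i => ?_) (fun i => ?_)
    · fin_cases i
      · exact hm 0
      · exact hm 1
      · exact hm 2
      · exact Ideal.add_mem _ (hm 3) (Ideal.mul_mem_left _ _ (hm 2))
    · have hv := vec_mem_span_range (![x 0, x 1, x 2, x 3 + δ * x 2] : Fin 4 → S)
      fin_cases i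
      · exact Ideal.mem_sup_left (by simpa using hv 0)
      · exact Ideal.mem_sup_left (by simpa using hv 1)
      · exact Ideal.mem_sup_left (by simpa using hv 2)
      · have h2 : x 2 ∈ Ideal.span (Set.range (![x 0, x 1, x 2, x 3 + δ * x 2] : Fin 4 → S)) := by
          simpa using hv 2
        have h3 : x 3 + δ * x 2 ∈
            Ideal.span (Set.range (![x 0, x 1, x 2, x 3 + δ * x 2] : Fin 4 → S)) := by
          simpa using hv 3
        have h : x 3 + δ * x 2 - δ * x 2 ∈
            Ideal.span (Set.range (![x 0, x 1, x 2, x 3 + δ * x 2] : Fin 4 → S)) :=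
          Ideal.sub_mem _ h3 (Ideal.mul_mem_left _ δ h2)
        rw [add_sub_cancel_right] at h
        exact Ideal.mem_sup_left h
  · simp only [Matrix.cons_val_zero, Matrix.cons_val_one, Matrix.cons_val]
    rw [hmdef, hδ, add_zero]
    linear_combination (-(γ * x 2 * (x 3 + γ * s * x 2) ^ 2)) * hs

include hx in
/-- **Step C — rescaling the units away**: for units `ε`, `λ`,
`z₀z₁ + ε z₂² + λ z₃³ = η · (w₀w₁ + w₂² + w₃³)` with `w = (ε⁻³λ² z₀, z₁, ε⁻¹λ z₂, ε⁻¹λ z₃)` again a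
generating family of `𝔪` and `η = ε³λ⁻²`. [folklore] -/
theorem coneTail_rescale (ε lam : S) (hε : IsUnit ε) (hlam : IsUnit lam) :
    ∃ (w : Fin 4 → S), Ideal.span (Set.range w) = 𝔪 ∧ ∃ (η : S), IsUnit η ∧
      x 0 * x 1 + ε * x 2 ^ 2 + lam * x 3 ^ 3 = η * (w 0 * w 1 + w 2 ^ 2 + w 3 ^ 3) := by
  have hm := rsop_mem x hx
  obtain ⟨e', he'⟩ := hε.exists_right_inv
  obtain ⟨l', hl'⟩ := hlam.exists_right_inv
  have hl'u : IsUnit l' := IsUnit.of_mul_eq_one lam ((mul_comm l' lam).trans hl')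
  refine ⟨![(e' * lam) ^ 2 * e' * x 0, x 1, e' * lam * x 2, e' * lam * x 3], ?_,
    ε * (ε * l') ^ 2, hε.mul ((hε.mul hl'u).pow 2), ?_⟩
  · have hv := vec_mem_span_range
      (![(e' * lam) ^ 2 * e' * x 0, x 1, e' * lam * x 2, e' * lam * x 3] : Fin 4 → S)
    refine span_eq_maximalIdeal_of_forall_mem_sup x _ hx (fun i => ?_) (fun i => ?_)
    · fin_cases i
      · exact Ideal.mul_mem_left _ _ (hm 0)
      · exact hm 1
      · exact Ideal.mul_mem_left _ _ (hm 2)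
      · exact Ideal.mul_mem_left _ _ (hm 3)
    · fin_cases i
      · -- `x₀ = ε³ l'² · w₀`
        have h := Ideal.mul_mem_left _ (ε ^ 3 * l' ^ 2) (by simpa using hv 0)
        have e : ε ^ 3 * l' ^ 2 * ((e' * lam) ^ 2 * e' * x 0) = x 0 := by
          linear_combination (x 0 * (1 + ε * e' + (ε * e') ^ 2) * (lam * l') ^ 2) * he' +
            (x 0 * (1 + lam * l')) * hl'
        rw [e] at h
        refine Ideal.mem_sup_left ?_
        simpa using h
      · exact Ideal.mem_sup_left (by simpa using hv 1)
      · have h := Ideal.mul_mem_left _ (ε * l') (by simpa using hv 2)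
        have e : ε * l' * (e' * lam * x 2) = x 2 := by
          linear_combination (x 2 * (lam * l')) * he' + (x 2) * hl'
        rw [e] at h
        refine Ideal.mem_sup_left ?_
        simpa using h
      · have h := Ideal.mul_mem_left _ (ε * l') (by simpa using hv 3)
        have e : ε * l' * (e' * lam * x 3) = x 3 := by
          linear_combination (x 3 * (lam * l')) * he' + (x 3) * hl'
        rw [e] at h
        refine Ideal.mem_sup_left ?_
        simpa using h
  · simp only [Matrix.cons_val_zero, Matrix.cons_val_one, Matrix.cons_val]
    -- `1 - Pᵃ Q² = -(P - 1)(1 + P + … + Pᵃ⁻¹) - Pᵃ (Q - 1)(1 + Q)`, `P = ε e'`, `Q = λ l'`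
    linear_combination
      (-(x 0 * x 1 * (1 + ε * e' + (ε * e') ^ 2) + ε * x 2 ^ 2 * (1 + ε * e') +
        lam * x 3 ^ 3 * (1 + ε * e' + (ε * e') ^ 2))) * he' +
      (-(x 0 * x 1 * (ε * e') ^ 3 * (1 + lam * l') + ε * x 2 ^ 2 * (ε * e') ^ 2 * (1 + lam * l') +
        lam * x 3 ^ 3 * (ε * e') ^ 3 * (1 + lam * l'))) * hl'

include hx in
/-- **The normal form of a non-permissible tail**: for `p ∈ (x₀,x₁,x₂)·𝔪²` and a UNIT `λ`
there are a generating family `y` of `𝔪`, a unit `η` and `r ∈ 𝔪⁴` with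
`x₀x₁ + x₂² + p + λx₃³ = η · (y₀y₁ + y₂² + y₃³) + r` — the member `(x₀x₁ + x₂² + p + λx₃³) + 𝔪⁴`
is the contact-migration member `(y₀y₁ + y₂² + y₃³) + 𝔪⁴` in the new parameters. [folklore] -/
theorem exists_rsop_coneCube_of_isUnit (p : S) (hp : p ∈ Ideal.span {x 0, x 1, x 2} * 𝔪 ^ 2)
    (lam : S) (hlam : IsUnit lam) :
    ∃ (y : Fin 4 → S), Ideal.span (Set.range y) = 𝔪 ∧ ∃ (η r : S), IsUnit η ∧ r ∈ 𝔪 ^ 4 ∧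
      x 0 * x 1 + x 2 ^ 2 + p + lam * x 3 ^ 3 = η * (y 0 * y 1 + y 2 ^ 2 + y 3 ^ 3) + r := by
  obtain ⟨y, hy, -, hy3, ε, γ, r, hε, hr, hid⟩ := coneTail_absorb x hx p hp
  have step2 : ∃ (z : Fin 4 → S), Ideal.span (Set.range z) = 𝔪 ∧
      ∃ (ε' r' : S), IsUnit ε' ∧ r' ∈ 𝔪 ^ 4 ∧
        y 0 * y 1 + ε * y 2 ^ 2 + γ * (y 2 * y 3 ^ 2) + lam * y 3 ^ 3 =
          z 0 * z 1 + ε' * z 2 ^ 2 + lam * z 3 ^ 3 + r' := by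
    rcases isUnit_two_or_three (S := S) with h2 | h3
    · exact coneTail_kill_two y hy h2 ε γ lam hε
    · exact coneTail_kill_three y hy h3 ε γ lam hε hlam
  obtain ⟨z, hz, ε', r', hε', hr', hid2⟩ := step2
  obtain ⟨w, hw, η, hη, hid3⟩ := coneTail_rescale z hz ε' lam hε' hlam
  refine ⟨w, hw, η, r + r', hη, Ideal.add_mem _ hr hr', ?_⟩
  calc x 0 * x 1 + x 2 ^ 2 + p + lam * x 3 ^ 3
      = (y 0 * y 1 + ε * y 2 ^ 2 + γ * (y 2 * y 3 ^ 2) + lam * y 3 ^ 3) + r := by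
        rw [hid, hy3]; ring
    _ = (z 0 * z 1 + ε' * z 2 ^ 2 + lam * z 3 ^ 3 + r') + r := by rw [hid2]
    _ = η * (w 0 * w 1 + w 2 ^ 2 + w 3 ^ 3) + (r + r') := by rw [hid3]; ring

end NormalForm

end ConeRung

end Summit.ResolutionOfSingularities.ResolutionOfSingularities.Theorems

end
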